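/-
Copyright (c) 2026 the pub-hodgecm-mathlib formalisation cell (harness21).  Prover seat hodgecm-mathlib-F0P3a-p08 (g20): road «S3-ram» (LEAD F0P3a-plan (g13);
owner F0P3a-p06 (g15)), (T2) G-side organ (Cnt2′) (chair F0P3a-p07 (g14) RULING (6): «PARITY REMARKS» for the rows `0` ∕ `1±`); 2026-09-02.
-/
import Literature.NumberTheory.Automorphic.UnitaryLatticeTreeCentredTokensDictionary   -- ★ p848132 (F0P3a-p05 (g17)): centred ↔ plain tokens (`map_sub_smul_one_le_scaleLattice_iff_map_sub_one_le`), `coe_inv_mul_mul_sub_smul_one_eq_conj`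
import Literature.NumberTheory.Automorphic.UnitaryLatticeTreeFixedChildTokensRamified    -- ★ FILE H (F0P2-p01): `map_toLin'_latt_le_scaleLattice_iff` (tokens ↔ entries of `g⁻¹Ag`)
import Literature.NumberTheory.Automorphic.UnitaryLatticeTreeStabilizer                  -- ★ `mapGL_latt_eq_latt_iff` (`γ·latt g = latt g ↔ g⁻¹γ^{±1}g` integral)
import Literature.NumberTheory.Automorphic.UnitaryLatticeTreeNilpotentVertexKernelTestRamified  -- ★ `v_le_of_lt_one` (discreteness `|z| < 1 ⇒ |z| ≤ |ϖ|`)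
import Literature.NumberTheory.Automorphic.UnitaryConjClassClosed                         -- ★ `formCongr_mul`, `formCongr_mul_of_mem`, `map_transpose_formCongr`
import Literature.NumberTheory.Automorphic.UnitaryLatticeTreeNilpotencyTokenOfDepths         -- ★ ROW-N: `v_mul_apply_le_of_forall_v_le` (entries of a product)
import HarnessLib

/-!
# The lattice graph of a hermitian PLANE — PARITY REMARKS for a type-(2) block: `(Y − c)² = (c² − det Y)·1`, «no `bd` on the `W`-side», «`LEV₂(ϖ³)` is automatic»,
# «centred depths are odd» (tame-ramified place; Bruhat–Tits 1972 §10; Kottwitz 1986 §3; Rogawski 1990 §4.8–4.9)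

Topic `NumberTheory/Automorphic`; namespace `Literature.NumberTheory.Automorphic.UnitaryLatticeTree`.  THEOREMS ONLY (no definition, no instance, no notation, no named fact,
no `sorry`); kernel lane `--supports stmt-HodgeConjecture-24833`; datum-free (`K` with `Valued K ℤᵐ⁰`).  Cell `pub/hodgecm-mathlib` (D-0151), crux H413; road «S3-ram»
(Literature seeding, count-neutral); (T2) G-side organ (Cnt2′) of the fold (chair F0P3a-p07 (g14)), rows `0` ∕ `1±` ((z4) assembly, architect A-p12 (g24); (z1-e) axis summands
★ p847852; (z1-f) `W`-side currency ★ p848132, F0P3a-p05 (g17)) — RULING (6) «PARITY REMARKS» dealt to this seat: the three rank-2 facts the axis∕`W`-side bookkeeping uses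
about a type-(2) block `γ₂` (`2 × 2`, `tr γ₂ = 2c`, centred operator `Z = γ₂ − c·1`, `Z² = (c² − det γ₂)·1 =: D·1`, `D` deep) acting on SELF-DUAL rank-2 lattices `B` of a
σ-hermitian plane `(K², H₂)` it fixes:
* (R1) **`(Y − c·1)² = (c² − det Y)·1`** when `tr Y = 2c` (2 × 2 Cayley–Hamilton, centred form), and `(Y − 1)² = (c² − det Y)·1 + 2(c−1)·(Y − c·1) + (c−1)²·1`;
* (W1) **«NO `bd` ON THE `W`-SIDE»**: if `|c − 1| < 1` and `|D| < 1`, every `γ₂`-fixed self-dual `B` has `(γ₂ − 1)·B ⊆ ϖ·B` — residually `γ̄₂′ = 1 + Z̄′` is a unipotent element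
  of the ORTHOGONAL group of the (residually symmetric) Gram form of `B`, `S̄ = Ḡ Z̄′` is antisymmetric with `det S̄ = det Ḡ · det Z̄′ = 0`, and an antisymmetric `2 × 2`
  matrix with zero determinant vanishes (`2 ≠ 0`);
* (W2) **«`LEV₂(ϖ³)` IS AUTOMATIC»**: `|c − 1| ≤ |ϖ|²`, `|D| ≤ |ϖ|⁴` and `(γ₂ − 1)·B ⊆ ϖ·B` give `(γ₂ − 1)²·B ⊆ ϖ³·B` (by (R1); any `𝒪`-lattice `B`, no form needed);
* (W3) **«CENTRED DEPTHS ARE ODD»**: if `(γ₂ − c·1)·B ⊆ ϖ^k·B` with `k` EVEN, `k ≥ 1`, and `|D| < |ϖ|^{2k}` (strictly above the bottom), then `(γ₂ − c·1)·B ⊆ ϖ^{k+1}·B` — the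
  first-order unitarity relation `Ḡ T̄ + (−1)^k T̄ᵀ Ḡ = 0` (`T = ϖ^{−k}Z′`, `σϖ = −ϖ`, `σ` residually trivial) makes `Ḡ T̄` antisymmetric at even `k`, and `T̄² = 0` kills it as
  in (W1); the rank-2 twin of ★ `UnitaryLatticeTreeEvenDepthRankRamified`.
CONSEQUENCES for the (z1-e) currency (§5): the axis `bd` and `reg` summands VANISH and the `LEV₂(ϖ³)` clause of the `1±` summands is redundant.

HONEST LABEL: HC_CM is proved only modulo the 2 remaining named inputs (hLiu418 24832, h413 24833) until rung 0 closes; nothing printed is asserted here (2 × 2 matrix algebra over a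
valuation ring); «S3-ram» has no books consequence.

## References
* [BruhatTits1972] F. Bruhat, J. Tits, *Groupes réductifs sur un corps local I*, Publ. Math. IHÉS 41 (1972), §10 (vertex stabilisers and their congruence filtrations).
* [Kottwitz1986] R. E. Kottwitz, *Base change for unit elements of Hecke algebras*, Compositio Math. 60 (1986), §3 (levels of fixed lattices).
* [Rogawski1990] J. D. Rogawski, *Automorphic Representations of Unitary Groups in Three Variables*, Ann. of Math. Stud. 123 (1990), §4.8 Case (a) p. 53, §4.9 p. 55.
* [Lang2002] S. Lang, *Algebra*, GTM 211 (2002), Ch. XIV §3 (Cayley–Hamilton).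
-/

set_option autoImplicit false

noncomputable section

open scoped Valued WithZero Matrix MatrixGroups

namespace Literature.NumberTheory.Automorphic.UnitaryLatticeTree

open Literature.NumberTheory.Automorphic Literature.NumberTheory.Automorphic.HermitianLattice

variable {K : Type*} [Field K] [Valued K ℤᵐ⁰] {σ : K →+* K}

/-! ## §1 (R1) The centred Cayley–Hamilton identity for a `2 × 2` matrix -/

omit [Valued K ℤᵐ⁰] in
/-- **(R1) `(Y − c·1)² = (c² − det Y)·1`** for a `2 × 2` matrix with `tr Y = 2c`. [cite: Lang2002, Ch. XIV §3 p. 561] -/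
theorem sub_smul_one_sq_eq_smul_one_of_trace_eq (Y : Matrix (Fin 2) (Fin 2) K) {c : K} (htr : Y.trace = 2 * c) :
    (Y - c • (1 : Matrix (Fin 2) (Fin 2) K)) ^ 2 = (c ^ 2 - Y.det) • (1 : Matrix (Fin 2) (Fin 2) K) := by
  have h00 : Y 0 0 + Y 1 1 = 2 * c := by rw [← htr, Matrix.trace_fin_two]
  ext i j
  fin_cases i <;> fin_cases j <;>
    simp [pow_two, Matrix.mul_apply, Fin.sum_univ_two, Matrix.det_fin_two, Matrix.sub_apply, Matrix.smul_apply, Matrix.one_apply]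
  · linear_combination (Y 0 0) * h00
  · linear_combination (Y 0 1) * h00
  · linear_combination (Y 1 0) * h00
  · linear_combination (Y 1 1) * h00

omit [Valued K ℤᵐ⁰] in
/-- **(R1′)** `(Y − 1)² = (c² − det Y)·1 + (2(c − 1))·(Y − c·1) + (c − 1)²·1` (`tr Y = 2c`). [cite: Lang2002, Ch. XIV §3 p. 561] -/
theorem sub_one_sq_eq_of_trace_eq (Y : Matrix (Fin 2) (Fin 2) K) {c : K} (htr : Y.trace = 2 * c) :
    (Y - 1) ^ 2 = (c ^ 2 - Y.det) • (1 : Matrix (Fin 2) (Fin 2) K) + (2 * (c - 1)) • (Y - c • (1 : Matrix (Fin 2) (Fin 2) K)) + ((c - 1) ^ 2) • (1 : Matrix (Fin 2) (Fin 2) K) := by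
  have h00 : Y 0 0 + Y 1 1 = 2 * c := by rw [← htr, Matrix.trace_fin_two]
  ext i j
  fin_cases i <;> fin_cases j <;>
    simp [pow_two, Matrix.mul_apply, Fin.sum_univ_two, Matrix.det_fin_two, Matrix.sub_apply, Matrix.smul_apply, Matrix.one_apply, Matrix.add_apply]
  · linear_combination (Y 0 0) * h00
  · linear_combination (Y 0 1) * h00
  · linear_combination (Y 1 0) * h00
  · linear_combination (Y 1 1) * h00

/-! ## §2 (W2) `LEV₂(ϖ³)` is automatic -/

/-- **(W2) «`LEV₂(ϖ³)` IS AUTOMATIC ON THE `W`-SIDE»**: for a `2 × 2` matrix `Y` with `tr Y = 2c`, `|c − 1| ≤ |ϖ|²`, `|c² − det Y| ≤ |ϖ|⁴`, and an `𝒪`-lattice `B` with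
`(Y − 1)·B ⊆ ϖ·B`: `(Y − 1)²·B ⊆ ϖ³·B`. [cite: Kottwitz1986, §3] [cite: Rogawski1990, §4.9 p. 55] -/
theorem map_sq_sub_one_le_scaleLattice_three_of_trace_eq {ϖ : K} (hϖ : Valued.v ϖ = WithZero.exp (-1 : ℤ)) (Y : Matrix (Fin 2) (Fin 2) K) {c : K}
    (htr : Y.trace = 2 * c) (hc : Valued.v (c - 1) ≤ Valued.v ϖ ^ 2) (hD : Valued.v (c ^ 2 - Y.det) ≤ Valued.v ϖ ^ 4)
    (B : Submodule 𝒪[K] (Fin 2 → K)) (hlev : B.map ((Matrix.toLin' (Y - 1)).restrictScalars 𝒪[K]) ≤ scaleLattice ϖ B) :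
    B.map ((Matrix.toLin' ((Y - 1) ^ 2)).restrictScalars 𝒪[K]) ≤ scaleLattice (ϖ ^ 3) B := by
  have hϖ0 : ϖ ≠ 0 := fun h0 => by rw [h0, map_zero] at hϖ; exact WithZero.coe_ne_zero hϖ.symm
  have hϖ1 : Valued.v ϖ ≤ 1 := by rw [hϖ, ← WithZero.exp_zero]; exact WithZero.exp_le_exp.2 (by norm_num)
  rw [← map_sq_sub_smul_one_le_iff_map_sq_sub_one_le hϖ Y hc B hlev, sub_smul_one_sq_eq_smul_one_of_trace_eq Y htr]
  refine map_toLin'_le_scaleLattice_of_eq_smul_add_smul (A := 0) (s := 0) (t := c ^ 2 - Y.det) (by rw [smul_zero, zero_add]) (by simp)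
    (pow_ne_zero 3 hϖ0) ?_ B ?_
  · rw [map_pow]; exact hD.trans (pow_le_pow_right_of_le_one' hϖ1 (by norm_num))
  · rw [map_zero, LinearMap.restrictScalars_zero, Submodule.map_zero]; exact bot_le

/-! ## §2½ Matrix helpers: `det(Y − c·1)`, and the `2 × 2` core «an integral `Z` with `ḠZ̄` alternating and `det Z̄ = 0` is residually zero», level form -/

omit [Valued K ℤᵐ⁰] in
/-- `det(Y − c·1) = det Y − c·tr Y + c²` for a `2 × 2` matrix. [cite: Lang2002, Ch. XIV §3 p. 561] -/
theorem det_sub_smul_one_fin_two (Y : Matrix (Fin 2) (Fin 2) K) (c : K) :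
    (Y - c • (1 : Matrix (Fin 2) (Fin 2) K)).det = Y.det - c * Y.trace + c ^ 2 := by
  simp [Matrix.det_fin_two, Matrix.trace_fin_two, Matrix.sub_apply, Matrix.smul_apply]
  ring

/-- **THE `2 × 2` CORE (level form).**  `G` integral with `|det G| = 1`, `Z` of level `ϖ^k` with `|det Z| ≤ |ϖ|^{2k+1}` and `G·Z` ALTERNATING one level down
(`|(GZ)_{ij} + (GZ)_{ji}| ≤ |ϖ|^{k+1}`, `|2| = 1`): then `Z` has level `ϖ^{k+1}` — an alternating `2 × 2` matrix `S̄ = ḠZ̄` has `det S̄ = S̄₀₁²`, which vanishes with `det Z̄`.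
[cite: BruhatTits1972, §10] [cite: Kottwitz1986, §3] -/
theorem forall_v_le_pow_succ_of_alternating_two {ϖ : K} (hϖ : Valued.v ϖ = WithZero.exp (-1 : ℤ)) (h2 : Valued.v (2 : K) = 1)
    {G Z : Matrix (Fin 2) (Fin 2) K} (hG : ∀ i j, Valued.v (G i j) ≤ 1) (hGdet : Valued.v G.det = 1) {k : ℕ}
    (hZ : ∀ i j, Valued.v (Z i j) ≤ Valued.v ϖ ^ k) (hdet : Valued.v Z.det ≤ Valued.v ϖ ^ (2 * k + 1))
    (halt : ∀ i j, Valued.v ((G * Z) i j + (G * Z) j i) ≤ Valued.v ϖ ^ (k + 1)) :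
    ∀ i j, Valued.v (Z i j) ≤ Valued.v ϖ ^ (k + 1) := by
  have hϖ1 : Valued.v ϖ ≤ 1 := by rw [hϖ, ← WithZero.exp_zero]; exact WithZero.exp_le_exp.2 (by norm_num)
  have hpow : ∀ {m n : ℕ}, n ≤ m → Valued.v ϖ ^ m ≤ Valued.v ϖ ^ n := fun {m n} h => pow_le_pow_right_of_le_one' hϖ1 h
  set S := G * Z with hS
  have hSle : ∀ i j, Valued.v (S i j) ≤ Valued.v ϖ ^ k := fun i j => by
    have h := v_mul_apply_le_of_forall_v_le hG hZ i j
    rwa [one_mul] at h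
  -- the diagonal of `S` is one level down (`|2| = 1`)
  have hdiag : ∀ i, Valued.v (S i i) ≤ Valued.v ϖ ^ (k + 1) := fun i => by
    have h := halt i i
    rwa [← two_mul, map_mul, h2, one_mul] at h
  -- `det S = det G · det Z` is two levels down
  have hdetS : Valued.v (S 0 0 * S 1 1 - S 0 1 * S 1 0) ≤ Valued.v ϖ ^ (2 * k + 1) := by
    rw [← Matrix.det_fin_two, hS, Matrix.det_mul, map_mul, hGdet, one_mul]; exact hdet
  have h0110 : Valued.v (S 0 1 * S 1 0) ≤ Valued.v ϖ ^ (2 * k + 1) := by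
    have heq : S 0 1 * S 1 0 = S 0 0 * S 1 1 - (S 0 0 * S 1 1 - S 0 1 * S 1 0) := by ring
    rw [heq]
    refine (Valuation.map_sub _ _ _).trans (max_le ?_ hdetS)
    rw [map_mul]
    calc Valued.v (S 0 0) * Valued.v (S 1 1) ≤ Valued.v ϖ ^ (k + 1) * Valued.v ϖ ^ (k + 1) := mul_le_mul' (hdiag 0) (hdiag 1)
      _ = Valued.v ϖ ^ (2 * k + 2) := by rw [← pow_add]; congr 1; omega
      _ ≤ Valued.v ϖ ^ (2 * k + 1) := hpow (by omega)
  -- off-diagonal: `S₀₁² = S₀₁(S₀₁ + S₁₀) − S₀₁S₁₀`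
  have hoff : ∀ i j, i ≠ j → Valued.v (S i j) ≤ Valued.v ϖ ^ (k + 1) := by
    intro i j hij
    have hprod : Valued.v (S i j * S j i) ≤ Valued.v ϖ ^ (2 * k + 1) := by
      fin_cases i <;> fin_cases j
      · exact absurd rfl hij
      · exact h0110
      · rw [mul_comm]; exact h0110
      · exact absurd rfl hij
    refine v_le_succ_of_sq_le hϖ (hSle i j) ?_
    have heq : S i j * S i j = S i j * (S i j + S j i) - S i j * S j i := by ring
    rw [heq]
    refine (Valuation.map_sub _ _ _).trans (max_le ?_ hprod)
    rw [map_mul]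
    calc Valued.v (S i j) * Valued.v (S i j + S j i) ≤ Valued.v ϖ ^ k * Valued.v ϖ ^ (k + 1) := mul_le_mul' (hSle i j) (halt i j)
      _ = Valued.v ϖ ^ (2 * k + 1) := by rw [← pow_add]; congr 1; omega
  have hSall : ∀ i j, Valued.v (S i j) ≤ Valued.v ϖ ^ (k + 1) := fun i j => by
    by_cases hij : i = j
    · subst hij; exact hdiag i
    · exact hoff i j hij
  -- `Z = G⁻¹ S` with `G⁻¹` integral
  have hGinv : IsIntMatrix G⁻¹ := isIntMatrix_nonsing_inv_of_v_det_eq_one hG hGdet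
  have hGunit : IsUnit G.det := by
    rw [isUnit_iff_ne_zero]; intro h0; rw [h0, map_zero] at hGdet; exact zero_ne_one hGdet
  have hZeq : Z = G⁻¹ * S := by rw [hS, ← Matrix.mul_assoc, Matrix.nonsing_inv_mul _ hGunit, Matrix.one_mul]
  intro i j
  rw [hZeq]
  have h := v_mul_apply_le_of_forall_v_le hGinv hSall i j
  rwa [one_mul] at h

/-- **THE FRAME OF A FIXED SELF-DUAL RANK-2 LATTICE.**  For `γ₂ ∈ U(σ, H₂)` (`H₂` σ-hermitian, `σ` a valuation-preserving involution, residually trivial) and a self-dual `B`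
with `γ₂·B = B`: `B = latt g` with an integral unimodular residually SYMMETRIC Gram matrix `G = ᵗσ(g)H₂g`, and `γ′ = g⁻¹γ₂g` integral, `G`-unitary (`ᵗσ(γ′)Gγ′ = G`), with
`tr γ′ = tr γ₂`, `det γ′ = det γ₂`. [cite: BruhatTits1972, §10] [cite: Kottwitz1986, §3] -/
theorem exists_frame_of_fixed_selfDual_two (hσ : ∀ x, σ (σ x) = x) {ϖ : K}
    (hres : ∀ x : K, Valued.v x ≤ 1 → Valued.v (σ x - x) < 1)
    {H₂ : Matrix (Fin 2) (Fin 2) K} (hH₂ : (H₂.map σ)ᵀ = H₂) {γ₂ : GL (Fin 2) K} (hγ : γ₂ ∈ unitaryGroupOfForm σ H₂)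
    {B : Submodule 𝒪[K] (Fin 2 → K)} (hB : IsSelfDualLattice σ ϖ H₂ B) (hfix : mapGL γ₂ B = B) :
    ∃ g : GL (Fin 2) K, B = latt (g : Matrix (Fin 2) (Fin 2) K) ∧ IsIntMatrix (formCongr σ g H₂) ∧ Valued.v (formCongr σ g H₂).det = 1 ∧
      (∀ i j, Valued.v (formCongr σ g H₂ i j - formCongr σ g H₂ j i) < 1) ∧
      IsIntMatrix ((g⁻¹ * γ₂ * g : GL (Fin 2) K) : Matrix (Fin 2) (Fin 2) K) ∧
      (((g⁻¹ * γ₂ * g : GL (Fin 2) K) : Matrix (Fin 2) (Fin 2) K).map σ)ᵀ * formCongr σ g H₂ * ((g⁻¹ * γ₂ * g : GL (Fin 2) K) : Matrix (Fin 2) (Fin 2) K) = formCongr σ g H₂ ∧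
      ((g⁻¹ * γ₂ * g : GL (Fin 2) K) : Matrix (Fin 2) (Fin 2) K).trace = (γ₂ : Matrix (Fin 2) (Fin 2) K).trace ∧
      ((g⁻¹ * γ₂ * g : GL (Fin 2) K) : Matrix (Fin 2) (Fin 2) K).det = (γ₂ : Matrix (Fin 2) (Fin 2) K).det := by
  obtain ⟨g, rfl, hGi, -, hGdet⟩ := hB
  rw [pow_zero] at hGdet
  have hsym : ((formCongr σ g H₂).map σ)ᵀ = formCongr σ g H₂ := map_transpose_formCongr σ H₂ hH₂ hσ g
  refine ⟨g, rfl, hGi, hGdet, fun i j => ?_, ((mapGL_latt_eq_latt_iff γ₂ g).1 hfix).1, ?_, ?_, ?_⟩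
  · have hji : formCongr σ g H₂ i j = σ (formCongr σ g H₂ j i) := by
      conv_lhs => rw [← hsym]
      rfl
    rw [hji]
    exact hres _ (hGi j i)
  · -- unitarity in the frame: `formCongr σ (g * γ′) H₂ = formCongr σ (γ₂ * g) H₂ = formCongr σ g H₂`
    have h := formCongr_mul σ H₂ g (g⁻¹ * γ₂ * g)
    rw [show g * (g⁻¹ * γ₂ * g) = γ₂ * g by rw [← mul_assoc, ← mul_assoc, mul_inv_cancel, one_mul], formCongr_mul_of_mem σ H₂ hγ g] at h
    exact h.symm
  · rw [Units.val_mul, Units.val_mul, Matrix.trace_mul_cycle, ← Units.val_mul, mul_inv_cancel, Units.val_one, Matrix.one_mul]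
  · rw [Units.val_mul, Units.val_mul, Matrix.det_mul, Matrix.det_mul, mul_comm (((g⁻¹ : GL (Fin 2) K) : Matrix (Fin 2) (Fin 2) K)).det, mul_assoc,
      ← Matrix.det_mul, ← Units.val_mul, inv_mul_cancel, Units.val_one, Matrix.det_one, mul_one]

/-! ## §3 (W1) No `bd` on the `W`-side: a deep type-(2) block has level `ϖ` at every fixed self-dual lattice -/

/-- **(W1) «NO `bd` ON THE `W`-SIDE».**  `σ` valuation-preserving and residually trivial, `|2| = 1`, `H₂` σ-hermitian; `γ₂ ∈ U(σ, H₂)` with `tr γ₂ = 2c`, `|c − 1| < 1`,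
`|c² − det γ₂| < 1`; then every self-dual `B` (for `(σ, ϖ, H₂)`) with `γ₂·B = B` has `(γ₂ − 1)·B ⊆ ϖ·B`: the orthogonal group of a non-degenerate residual plane has no
unipotent element `≠ 1`. [cite: BruhatTits1972, §10] [cite: Kottwitz1986, §3] [cite: Rogawski1990, §4.8 Case (a) p. 53] -/
theorem map_sub_one_le_scaleLattice_of_fixed_selfDual_two (hσ : ∀ x, σ (σ x) = x) {ϖ : K} (hϖ : Valued.v ϖ = WithZero.exp (-1 : ℤ))
    (hres : ∀ x : K, Valued.v x ≤ 1 → Valued.v (σ x - x) < 1) (h2 : Valued.v (2 : K) = 1)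
    {H₂ : Matrix (Fin 2) (Fin 2) K} (hH₂ : (H₂.map σ)ᵀ = H₂) {γ₂ : GL (Fin 2) K} (hγ : γ₂ ∈ unitaryGroupOfForm σ H₂)
    {c : K} (htr : (γ₂ : Matrix (Fin 2) (Fin 2) K).trace = 2 * c) (hc : Valued.v (c - 1) < 1) (hD : Valued.v (c ^ 2 - (γ₂ : Matrix (Fin 2) (Fin 2) K).det) < 1)
    {B : Submodule 𝒪[K] (Fin 2 → K)} (hB : IsSelfDualLattice σ ϖ H₂ B) (hfix : mapGL γ₂ B = B) :
    B.map ((Matrix.toLin' ((γ₂ : Matrix (Fin 2) (Fin 2) K) - 1)).restrictScalars 𝒪[K]) ≤ scaleLattice ϖ B := by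
  have hϖ0 : ϖ ≠ 0 := fun h0 => by rw [h0, map_zero] at hϖ; exact WithZero.coe_ne_zero hϖ.symm
  have hϖ1 : Valued.v ϖ ≤ 1 := by rw [hϖ, ← WithZero.exp_zero]; exact WithZero.exp_le_exp.2 (by norm_num)
  have hc1 : Valued.v c ≤ 1 := by
    have h := Valuation.map_add Valued.v (c - 1) 1
    rw [sub_add_cancel, map_one] at h
    exact h.trans (max_le hc.le le_rfl)
  have hlt1 : ∀ {a b : ℤᵐ⁰}, a < 1 → b ≤ 1 → a * b < 1 := fun {a b} ha hb =>
    calc a * b ≤ a * 1 := mul_le_mul' le_rfl hb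
      _ < 1 := by rwa [mul_one]
  have hlt2 : ∀ {a b : ℤᵐ⁰}, a ≤ 1 → b < 1 → a * b < 1 := fun {a b} ha hb =>
    calc a * b ≤ 1 * b := mul_le_mul' ha le_rfl
      _ < 1 := by rwa [one_mul]
  obtain ⟨g, rfl, hGi, hGdet, hGsym, hγ'i, hU, htr', hdet'⟩ := exists_frame_of_fixed_selfDual_two hσ hres hH₂ hγ hB hfix
  set G := formCongr σ g H₂ with hGdef
  set γ' : Matrix (Fin 2) (Fin 2) K := ((g⁻¹ * γ₂ * g : GL (Fin 2) K) : Matrix (Fin 2) (Fin 2) K) with hγ'def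
  set N : Matrix (Fin 2) (Fin 2) K := γ' - 1 with hNdef
  have h1i : ∀ i j : Fin 2, Valued.v ((1 : Matrix (Fin 2) (Fin 2) K) i j) ≤ 1 := fun i j => by
    rw [Matrix.one_apply]; split_ifs <;> simp
  have hNi : ∀ i j, Valued.v (N i j) ≤ 1 := fun i j => by
    rw [hNdef, Matrix.sub_apply]; exact (Valuation.map_sub _ _ _).trans (max_le (hγ'i i j) (h1i i j))
  -- `N²` is residually zero: `(γ′ − 1)² = D·1 + 2(c−1)(γ′ − c) + (c−1)²·1`
  have hZ'i : ∀ i j, Valued.v ((γ' - c • (1 : Matrix (Fin 2) (Fin 2) K)) i j) ≤ 1 := fun i j => by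
    rw [Matrix.sub_apply, Matrix.smul_apply, smul_eq_mul]
    exact (Valuation.map_sub _ _ _).trans (max_le (hγ'i i j) (by rw [map_mul]; exact mul_le_one' hc1 (h1i i j)))
  have hN2 : ∀ i j, Valued.v ((N * N) i j) < 1 := by
    intro i j
    rw [← pow_two, hNdef, sub_one_sq_eq_of_trace_eq γ' (htr'.trans htr), hdet', Matrix.add_apply, Matrix.add_apply, Matrix.smul_apply, Matrix.smul_apply,
      Matrix.smul_apply, smul_eq_mul, smul_eq_mul, smul_eq_mul]
    refine (Valuation.map_add _ _ _).trans_lt (max_lt ((Valuation.map_add _ _ _).trans_lt (max_lt ?_ ?_)) ?_)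
    · rw [map_mul]; exact hlt1 hD (h1i i j)
    · rw [map_mul, map_mul, h2, one_mul]; exact hlt1 hc (hZ'i i j)
    · rw [map_mul, map_pow, pow_two]; exact hlt1 (hlt1 hc hc.le) (h1i i j)
  -- unitarity: `(σN)ᵀG + GN + (σN)ᵀGN = 0`
  have hγ'N : γ' = 1 + N := by rw [hNdef, add_sub_cancel]
  have hE : (N.map σ)ᵀ * G + G * N + (N.map σ)ᵀ * G * N = 0 := by
    have h := hU
    rw [hγ'N, Matrix.map_add σ (map_add σ), Matrix.map_one σ (map_zero σ) (map_one σ), Matrix.transpose_add, Matrix.transpose_one] at h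
    have h' : (1 + (N.map σ)ᵀ) * G * (1 + N) = G + ((N.map σ)ᵀ * G + G * N + (N.map σ)ᵀ * G * N) := by noncomm_ring
    rw [h'] at h
    exact add_eq_left.1 h
  -- `Q := (σN)ᵀGN = −G·N²·γ′⁻¹` is residually zero
  have hγ'inv : IsIntMatrix γ'⁻¹ := by
    rw [hγ'def, ← Matrix.coe_units_inv]
    have h := ((mapGL_latt_eq_latt_iff γ₂ g).1 hfix).2
    rwa [show g⁻¹ * γ₂⁻¹ * g = (g⁻¹ * γ₂ * g)⁻¹ by rw [mul_inv_rev, mul_inv_rev, inv_inv, mul_assoc]] at h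
  have hγ'unit : IsUnit γ'.det := by rw [hγ'def]; exact Matrix.isUnits_det_units _
  have hQ : (N.map σ)ᵀ * G * N = -(G * (N * N) * γ'⁻¹) := by
    have h1 : ((N.map σ)ᵀ * G + G * N + (N.map σ)ᵀ * G * N) * N = 0 := by rw [hE, Matrix.zero_mul]
    have h2' : (N.map σ)ᵀ * G * N * γ' = -(G * (N * N)) := by
      rw [hγ'N]
      have : ((N.map σ)ᵀ * G + G * N + (N.map σ)ᵀ * G * N) * N = (N.map σ)ᵀ * G * N * (1 + N) + G * (N * N) := by noncomm_ring
      rw [this] at h1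
      exact eq_neg_of_add_eq_zero_left h1
    calc (N.map σ)ᵀ * G * N = (N.map σ)ᵀ * G * N * γ' * γ'⁻¹ := by rw [Matrix.mul_assoc _ γ', Matrix.mul_nonsing_inv _ hγ'unit, Matrix.mul_one]
      _ = -(G * (N * N) * γ'⁻¹) := by rw [h2', Matrix.neg_mul]
  have hN2le : ∀ i j, Valued.v ((N * N) i j) ≤ Valued.v ϖ := fun i j => v_le_of_lt_one hϖ (hN2 i j)
  have hQlt : ∀ i j, Valued.v (((N.map σ)ᵀ * G * N) i j) < 1 := fun i j => by
    rw [hQ, Matrix.neg_apply, Valuation.map_neg]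
    have h := v_mul_apply_le_of_forall_v_le (v_mul_apply_le_of_forall_v_le hGi hN2le) hγ'inv i j
    rw [one_mul, mul_one] at h
    exact h.trans_lt (by rw [hϖ, ← WithZero.exp_zero]; exact WithZero.exp_lt_exp.2 (by norm_num))
  -- hence `(σN)ᵀG + GN` is residually zero, and `GN` is residually ALTERNATING
  have hsum : ∀ i j, Valued.v (((N.map σ)ᵀ * G) i j + (G * N) i j) < 1 := fun i j => by
    have h : ((N.map σ)ᵀ * G) i j + (G * N) i j = -(((N.map σ)ᵀ * G * N) i j) := by
      have := congrFun (congrFun hE i) j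
      rw [Matrix.add_apply, Matrix.add_apply, Matrix.zero_apply] at this
      exact eq_neg_of_add_eq_zero_left this
    rw [h, Valuation.map_neg]; exact hQlt i j
  have hswap : ∀ i j, Valued.v (((N.map σ)ᵀ * G) i j - (G * N) j i) < 1 := fun i j => by
    rw [Matrix.mul_apply, Matrix.mul_apply, ← Finset.sum_sub_distrib]
    refine (Valuation.map_sum_lt _ (by norm_num) fun l _ => ?_)
    rw [Matrix.transpose_apply, Matrix.map_apply,
      show σ (N l i) * G l j - G j l * N l i = (σ (N l i) - N l i) * G l j + N l i * (G l j - G j l) by ring]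
    refine (Valuation.map_add _ _ _).trans_lt (max_lt ?_ ?_)
    · rw [map_mul]; exact hlt1 (hres _ (hNi l i)) (hGi l j)
    · rw [map_mul]; exact hlt2 (hNi l i) (hGsym l j)
  have halt : ∀ i j, Valued.v ((G * N) i j + (G * N) j i) ≤ Valued.v ϖ ^ (0 + 1) := fun i j => by
    rw [zero_add, pow_one]
    refine v_le_of_lt_one hϖ ?_
    have h : (G * N) i j + (G * N) j i = (((N.map σ)ᵀ * G) i j + (G * N) i j) - (((N.map σ)ᵀ * G) i j - (G * N) j i) := by ring
    rw [h]
    exact (Valuation.map_sub _ _ _).trans_lt (max_lt (hsum i j) (hswap i j))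
  -- `det N = det γ₂ − tr γ₂ + 1 = −D + (c − 1)²` is residually zero
  have hdetN : Valued.v N.det ≤ Valued.v ϖ ^ (2 * 0 + 1) := by
    rw [mul_zero, zero_add, pow_one]
    refine v_le_of_lt_one hϖ ?_
    have h : N = γ' - (1 : K) • (1 : Matrix (Fin 2) (Fin 2) K) := by rw [hNdef, one_smul]
    rw [h, det_sub_smul_one_fin_two, htr', hdet', htr,
      show (γ₂ : Matrix (Fin 2) (Fin 2) K).det - 1 * (2 * c) + 1 ^ 2 = -(c ^ 2 - (γ₂ : Matrix (Fin 2) (Fin 2) K).det) + (c - 1) ^ 2 by ring]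
    refine (Valuation.map_add _ _ _).trans_lt (max_lt ?_ ?_)
    · rw [Valuation.map_neg]; exact hD
    · rw [map_pow, pow_two]; exact hlt1 hc hc.le
  -- the core: `N` has level `ϖ`
  have hN1 := forall_v_le_pow_succ_of_alternating_two hϖ h2 hGi hGdet (k := 0) (fun i j => by rw [pow_zero]; exact hNi i j) hdetN halt
  simp only [zero_add, pow_one] at hN1
  -- back to the lattice
  rw [map_toLin'_latt_le_scaleLattice_iff hϖ0 _ (Matrix.isUnits_det_units g)]
  intro i j
  have hconj : (g : Matrix (Fin 2) (Fin 2) K)⁻¹ * ((γ₂ : Matrix (Fin 2) (Fin 2) K) - 1) * (g : Matrix (Fin 2) (Fin 2) K) = N := by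
    have h := coe_inv_mul_mul_sub_smul_one_eq_conj γ₂ g (1 : K)
    simp only [one_smul] at h
    exact h.symm.trans (by rw [hNdef, hγ'def])
  rw [hconj]
  exact hN1 i j

/-! ## §4 (W3) Centred depths are odd -/

/-- **(W3) «CENTRED DEPTHS ARE ODD».**  Same datum plus `σϖ = −ϖ`; if `(γ₂ − c·1)·B ⊆ ϖ^k·B` with `k` even, `1 ≤ k`, and `|c² − det γ₂| < |ϖ|^{2k}` (the block is deeper
than `2k`), then `(γ₂ − c·1)·B ⊆ ϖ^{k+1}·B`: exact centred levels strictly above the bottom are ODD. [cite: BruhatTits1972, §10] [cite: Kottwitz1986, §3] [cite: Rogawski1990, §4.9 p. 55] -/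
theorem map_sub_smul_one_le_scaleLattice_succ_of_even_two (hσ : ∀ x, σ (σ x) = x) (hvσ : ∀ a, Valued.v (σ a) = Valued.v a) {ϖ : K} (hσϖ : σ ϖ = -ϖ) (hϖ : Valued.v ϖ = WithZero.exp (-1 : ℤ))
    (hres : ∀ x : K, Valued.v x ≤ 1 → Valued.v (σ x - x) < 1) (h2 : Valued.v (2 : K) = 1)
    {H₂ : Matrix (Fin 2) (Fin 2) K} (hH₂ : (H₂.map σ)ᵀ = H₂) {γ₂ : GL (Fin 2) K} (hγ : γ₂ ∈ unitaryGroupOfForm σ H₂)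
    {c : K} (htr : (γ₂ : Matrix (Fin 2) (Fin 2) K).trace = 2 * c) (hc : Valued.v (c - 1) < 1)
    {B : Submodule 𝒪[K] (Fin 2 → K)} (hB : IsSelfDualLattice σ ϖ H₂ B) (hfix : mapGL γ₂ B = B)
    {k : ℕ} (hk : Even k) (hk1 : 1 ≤ k) (hD : Valued.v (c ^ 2 - (γ₂ : Matrix (Fin 2) (Fin 2) K).det) < Valued.v ϖ ^ (2 * k))
    (hlev : B.map ((Matrix.toLin' ((γ₂ : Matrix (Fin 2) (Fin 2) K) - c • (1 : Matrix (Fin 2) (Fin 2) K))).restrictScalars 𝒪[K]) ≤ scaleLattice (ϖ ^ k) B) :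
    B.map ((Matrix.toLin' ((γ₂ : Matrix (Fin 2) (Fin 2) K) - c • (1 : Matrix (Fin 2) (Fin 2) K))).restrictScalars 𝒪[K]) ≤ scaleLattice (ϖ ^ (k + 1)) B := by
  have hϖ0 : ϖ ≠ 0 := fun h0 => by rw [h0, map_zero] at hϖ; exact WithZero.coe_ne_zero hϖ.symm
  have hϖ1 : Valued.v ϖ ≤ 1 := by rw [hϖ, ← WithZero.exp_zero]; exact WithZero.exp_le_exp.2 (by norm_num)
  have hvϖ0 : Valued.v ϖ ≠ 0 := (Valuation.ne_zero_iff _).2 hϖ0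
  have hpow : ∀ {m n : ℕ}, n ≤ m → Valued.v ϖ ^ m ≤ Valued.v ϖ ^ n := fun {m n} h => pow_le_pow_right_of_le_one' hϖ1 h
  -- discreteness: `|x| < |ϖ|^n ⇒ |x| ≤ |ϖ|^{n+1}`
  have hdisc : ∀ {x : K} {n : ℕ}, Valued.v x < Valued.v ϖ ^ n → Valued.v x ≤ Valued.v ϖ ^ (n + 1) := fun {x n} hx => by
    have hne : (Valued.v ϖ ^ n)⁻¹ ≠ 0 := inv_ne_zero (pow_ne_zero _ hvϖ0)
    have h : Valued.v ((ϖ ^ n)⁻¹ * x) < 1 := by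
      rw [map_mul, map_inv₀, map_pow]
      calc (Valued.v ϖ ^ n)⁻¹ * Valued.v x < (Valued.v ϖ ^ n)⁻¹ * Valued.v ϖ ^ n := mul_lt_mul_of_pos_left hx (zero_lt_iff.2 hne)
        _ = 1 := inv_mul_cancel₀ (pow_ne_zero _ hvϖ0)
    have h' := v_le_of_lt_one hϖ h
    rw [map_mul, map_inv₀, map_pow] at h'
    calc Valued.v x = Valued.v ϖ ^ n * ((Valued.v ϖ ^ n)⁻¹ * Valued.v x) := by rw [← mul_assoc, mul_inv_cancel₀ (pow_ne_zero _ hvϖ0), one_mul]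
      _ ≤ Valued.v ϖ ^ n * Valued.v ϖ := mul_le_mul' le_rfl h'
      _ = Valued.v ϖ ^ (n + 1) := by rw [pow_succ]
  -- `c` is a unit: `|c| = 1`, `|σc| = 1`, `|σc·c − 1| < |ϖ|^{2k}` below
  have hc1 : Valued.v c ≤ 1 := by
    have h := Valuation.map_add Valued.v (c - 1) 1
    rw [sub_add_cancel, map_one] at h
    exact h.trans (max_le hc.le le_rfl)
  have hcu : Valued.v c = 1 := by
    have h := Valuation.map_add_eq_of_lt_left Valued.v (x := (1 : K)) (y := c - 1) (by rw [map_one]; exact hc)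
    rwa [add_sub_cancel, map_one] at h
  obtain ⟨g, rfl, hGi, hGdet, hGsym, hγ'i, hU, htr', hdet'⟩ := exists_frame_of_fixed_selfDual_two hσ hres hH₂ hγ hB hfix
  set G := formCongr σ g H₂ with hGdef
  set γ' : Matrix (Fin 2) (Fin 2) K := ((g⁻¹ * γ₂ * g : GL (Fin 2) K) : Matrix (Fin 2) (Fin 2) K) with hγ'def
  set Z : Matrix (Fin 2) (Fin 2) K := γ' - c • (1 : Matrix (Fin 2) (Fin 2) K) with hZdef
  set D : K := c ^ 2 - (γ₂ : Matrix (Fin 2) (Fin 2) K).det with hDdef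
  -- the centred token in the frame: `|Z| ≤ |ϖ|^k`
  have hconj : (g : Matrix (Fin 2) (Fin 2) K)⁻¹ * ((γ₂ : Matrix (Fin 2) (Fin 2) K) - c • (1 : Matrix (Fin 2) (Fin 2) K)) * (g : Matrix (Fin 2) (Fin 2) K) = Z :=
    (coe_inv_mul_mul_sub_smul_one_eq_conj γ₂ g c).symm.trans (by rw [hZdef, hγ'def])
  have hZk : ∀ i j, Valued.v (Z i j) ≤ Valued.v ϖ ^ k := by
    have h := (map_toLin'_latt_le_scaleLattice_iff (pow_ne_zero k hϖ0) _ (Matrix.isUnits_det_units g)).1 hlev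
    intro i j; have h' := h i j; rwa [hconj, map_pow] at h'
  -- `det Z = −D`, two levels below `k`
  have hDle : Valued.v D ≤ Valued.v ϖ ^ (2 * k + 1) := hdisc hD
  have hdetZ : Valued.v Z.det ≤ Valued.v ϖ ^ (2 * k + 1) := by
    rw [hZdef, det_sub_smul_one_fin_two, htr', hdet', htr,
      show (γ₂ : Matrix (Fin 2) (Fin 2) K).det - c * (2 * c) + c ^ 2 = -D by rw [hDdef]; ring, Valuation.map_neg]
    exact hDle
  -- the norm of `det γ′ = c² − D` is `1`, hence `|σ(c)c − 1| < |ϖ|^{2k}`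
  have hNd : σ (γ'.det) * γ'.det = 1 := by
    have h := congrArg Matrix.det hU
    rw [Matrix.det_mul, Matrix.det_mul, Matrix.det_transpose, ← RingHom.mapMatrix_apply, ← RingHom.map_det] at h
    have hG0 : G.det ≠ 0 := fun h0 => by rw [h0, map_zero] at hGdet; exact zero_ne_one hGdet
    have h' : (σ γ'.det * γ'.det) * G.det = 1 * G.det := by rw [one_mul]; linear_combination h
    exact mul_right_cancel₀ hG0 h'
  have hdetc : γ'.det = c ^ 2 - D := by rw [hdet', hDdef]; ring
  have hu1 : Valued.v (σ c * c - 1) < Valued.v ϖ ^ (2 * k) := by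
    have hσc : Valued.v (σ c) ≤ 1 := by rw [hvσ]; exact hc1
    have hD1 : Valued.v D ≤ 1 := hD.le.trans (pow_le_one' hϖ1 _)
    -- `(σc·c)² − 1 = σc²·D + σD·c² − σD·D`
    have hid : (σ c * c) ^ 2 - 1 = σ c ^ 2 * D + σ D * c ^ 2 - σ D * D := by
      have h := hNd
      rw [hdetc, map_sub, map_pow] at h
      linear_combination h
    have hsq : Valued.v ((σ c * c) ^ 2 - 1) < Valued.v ϖ ^ (2 * k) := by
      rw [hid]
      refine (Valuation.map_sub _ _ _).trans_lt (max_lt ((Valuation.map_add _ _ _).trans_lt (max_lt ?_ ?_)) ?_)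
      · rw [map_mul, map_pow]
        calc Valued.v (σ c) ^ 2 * Valued.v D ≤ 1 * Valued.v D := mul_le_mul' (pow_le_one' hσc 2) le_rfl
          _ < Valued.v ϖ ^ (2 * k) := by rw [one_mul]; exact hD
      · rw [map_mul, map_pow, hvσ]
        calc Valued.v D * Valued.v c ^ 2 ≤ Valued.v D * 1 := mul_le_mul' le_rfl (pow_le_one' hc1 2)
          _ < Valued.v ϖ ^ (2 * k) := by rw [mul_one]; exact hD
      · rw [map_mul, hvσ]
        calc Valued.v D * Valued.v D ≤ Valued.v D * 1 := mul_le_mul' le_rfl hD1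
          _ < Valued.v ϖ ^ (2 * k) := by rw [mul_one]; exact hD
    -- `|σc·c − 1| < 1`, so `|σc·c + 1| = 1`
    have hlt : Valued.v (σ c * c - 1) < 1 := by
      rw [show σ c * c - 1 = σ c * (c - 1) + σ (c - 1) by rw [map_sub, map_one]; ring]
      refine (Valuation.map_add _ _ _).trans_lt (max_lt ?_ ?_)
      · rw [map_mul]
        calc Valued.v (σ c) * Valued.v (c - 1) ≤ 1 * Valued.v (c - 1) := mul_le_mul' hσc le_rfl
          _ < 1 := by rw [one_mul]; exact hc
      · rw [hvσ]; exact hc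
    have hplus : Valued.v (σ c * c + 1) = 1 := by
      have h := Valuation.map_add_eq_of_lt_left Valued.v (x := (2 : K)) (y := σ c * c - 1) (by rw [h2]; exact hlt)
      rw [show (2 : K) + (σ c * c - 1) = σ c * c + 1 by ring, h2] at h
      exact h
    have hfac : Valued.v (σ c * c - 1) = Valued.v ((σ c * c) ^ 2 - 1) := by
      rw [show (σ c * c) ^ 2 - 1 = (σ c * c - 1) * (σ c * c + 1) by ring, map_mul, hplus, mul_one]
    rw [hfac]; exact hsq
  -- the first-order unitarity relation: `σc·GZ + c·(σZ)ᵀG = (1 − σc·c)G − (σZ)ᵀGZ`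
  have hmap : ((c • (1 : Matrix (Fin 2) (Fin 2) K) + Z).map σ)ᵀ = σ c • (1 : Matrix (Fin 2) (Fin 2) K) + (Z.map σ)ᵀ := by
    ext i j
    by_cases hij : i = j
    · subst hij; simp
    · simp [hij, Ne.symm hij]
  have hexp : (σ c * c) • G + σ c • (G * Z) + c • ((Z.map σ)ᵀ * G) + (Z.map σ)ᵀ * G * Z = G := by
    have h := hU
    rw [show γ' = c • (1 : Matrix (Fin 2) (Fin 2) K) + Z by rw [hZdef, add_sub_cancel], hmap] at h
    have hx : (σ c • (1 : Matrix (Fin 2) (Fin 2) K) + (Z.map σ)ᵀ) * G * (c • (1 : Matrix (Fin 2) (Fin 2) K) + Z) =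
        (σ c * c) • G + σ c • (G * Z) + c • ((Z.map σ)ᵀ * G) + (Z.map σ)ᵀ * G * Z := by
      ext i j
      simp [Matrix.mul_apply, Fin.sum_univ_two, Matrix.add_apply, Matrix.smul_apply, Matrix.one_apply]
      fin_cases i <;> fin_cases j <;> simp <;> ring
    rw [hx] at h
    exact h
  -- entry bounds
  have hZσk : ∀ i j, Valued.v ((Z.map σ)ᵀ i j) ≤ Valued.v ϖ ^ k := fun i j => by
    rw [Matrix.transpose_apply, Matrix.map_apply, hvσ]; exact hZk j i
  have hGZ : ∀ i j, Valued.v ((G * Z) i j) ≤ Valued.v ϖ ^ k := fun i j => by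
    have h := v_mul_apply_le_of_forall_v_le hGi hZk i j; rwa [one_mul] at h
  have hZσG : ∀ i j, Valued.v (((Z.map σ)ᵀ * G) i j) ≤ Valued.v ϖ ^ k := fun i j => by
    have h := v_mul_apply_le_of_forall_v_le hZσk hGi i j; rwa [mul_one] at h
  have hquad : ∀ i j, Valued.v (((Z.map σ)ᵀ * G * Z) i j) ≤ Valued.v ϖ ^ (k + 1) := fun i j => by
    have h := v_mul_apply_le_of_forall_v_le hZσG hZk i j
    refine h.trans ?_
    rw [← pow_add]; exact hpow (by omega)
  -- (c): `|c·((GZ)ᵢⱼ + ((σZ)ᵀG)ᵢⱼ)| ≤ |ϖ|^{k+1}`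
  have hXY : ∀ i j, Valued.v ((G * Z) i j + ((Z.map σ)ᵀ * G) i j) ≤ Valued.v ϖ ^ (k + 1) := by
    intro i j
    have hent := congrFun (congrFun hexp i) j
    simp only [Matrix.add_apply, Matrix.smul_apply, smul_eq_mul] at hent
    -- `c·(X + Y) = (1 − σc·c)·Gᵢⱼ − (σc − c)·Xᵢⱼ − Qᵢⱼ`
    have hid : c * ((G * Z) i j + ((Z.map σ)ᵀ * G) i j) =
        -((σ c * c - 1) * G i j) - (σ c - c) * (G * Z) i j - ((Z.map σ)ᵀ * G * Z) i j := by linear_combination hent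
    have hσcc : Valued.v (σ c - c) < 1 := hres c hc1
    have hc' : Valued.v (c * ((G * Z) i j + ((Z.map σ)ᵀ * G) i j)) ≤ Valued.v ϖ ^ (k + 1) := by
      rw [hid]
      refine (Valuation.map_sub _ _ _).trans (max_le ((Valuation.map_sub _ _ _).trans (max_le ?_ ?_)) (hquad i j))
      · rw [Valuation.map_neg, map_mul]
        calc Valued.v (σ c * c - 1) * Valued.v (G i j) ≤ Valued.v (σ c * c - 1) * 1 := mul_le_mul' le_rfl (hGi i j)
          _ ≤ Valued.v ϖ ^ (2 * k + 1) := by rw [mul_one]; exact hdisc hu1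
          _ ≤ Valued.v ϖ ^ (k + 1) := hpow (by omega)
      · rw [map_mul]
        calc Valued.v (σ c - c) * Valued.v ((G * Z) i j) ≤ Valued.v ϖ * Valued.v ϖ ^ k := mul_le_mul' (v_le_of_lt_one hϖ hσcc) (hGZ i j)
          _ = Valued.v ϖ ^ (k + 1) := by rw [pow_succ, mul_comm]
    rwa [map_mul, hcu, one_mul] at hc'
  -- (d): `((σZ)ᵀG)ᵢⱼ ≡ (GZ)ⱼᵢ (mod ϖ^{k+1})` (`σ` trivial at even level, `G` residually symmetric)
  have hswap : ∀ i j, Valued.v (((Z.map σ)ᵀ * G) i j - (G * Z) j i) ≤ Valued.v ϖ ^ (k + 1) := fun i j => by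
    rw [Matrix.mul_apply, Matrix.mul_apply, ← Finset.sum_sub_distrib]
    refine Valuation.map_sum_le _ fun l _ => ?_
    rw [Matrix.transpose_apply, Matrix.map_apply,
      show σ (Z l i) * G l j - G j l * Z l i = (σ (Z l i) - Z l i) * G l j + Z l i * (G l j - G j l) by ring]
    refine (Valuation.map_add _ _ _).trans (max_le ?_ ?_)
    · rw [map_mul]
      calc Valued.v (σ (Z l i) - Z l i) * Valued.v (G l j) ≤ Valued.v ϖ ^ (k + 1) * 1 :=
            mul_le_mul' (v_sigma_sub_self_le_of_even hσϖ hϖ hres hk (hZk l i)) (hGi l j)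
        _ = Valued.v ϖ ^ (k + 1) := mul_one _
    · rw [map_mul]
      calc Valued.v (Z l i) * Valued.v (G l j - G j l) ≤ Valued.v ϖ ^ k * Valued.v ϖ := mul_le_mul' (hZk l i) (v_le_of_lt_one hϖ (hGsym l j))
        _ = Valued.v ϖ ^ (k + 1) := by rw [pow_succ]
  -- (e): `GZ` is alternating one level down
  have halt : ∀ i j, Valued.v ((G * Z) i j + (G * Z) j i) ≤ Valued.v ϖ ^ (k + 1) := fun i j => by
    rw [show (G * Z) i j + (G * Z) j i = ((G * Z) i j + ((Z.map σ)ᵀ * G) i j) - (((Z.map σ)ᵀ * G) i j - (G * Z) j i) by ring]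
    exact (Valuation.map_sub _ _ _).trans (max_le (hXY i j) (hswap i j))
  -- the core
  have hZ1 := forall_v_le_pow_succ_of_alternating_two hϖ h2 hGi hGdet hZk hdetZ halt
  rw [map_toLin'_latt_le_scaleLattice_iff (pow_ne_zero (k + 1) hϖ0) _ (Matrix.isUnits_det_units g)]
  intro i j
  rw [hconj, map_pow]
  exact hZ1 i j

/-! ## §5 Consequences in the (z1-e) `W`-side currency: the `bd` and `reg` summands vanish, `LEV₂(ϖ³)` is redundant in `1±` -/

/-- **The `W`-side `bd` set is EMPTY** for a deep type-(2) block (`|c − 1| < 1`, `|c² − det| < 1`). [cite: Kottwitz1986, §3] [cite: Rogawski1990, §4.8 Case (a) p. 53] -/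
theorem setOf_selfDual_fixed_bd_two_eq_empty (hσ : ∀ x, σ (σ x) = x) {ϖ : K} (hϖ : Valued.v ϖ = WithZero.exp (-1 : ℤ))
    (hres : ∀ x : K, Valued.v x ≤ 1 → Valued.v (σ x - x) < 1) (h2 : Valued.v (2 : K) = 1)
    {H₂ : Matrix (Fin 2) (Fin 2) K} (hH₂ : (H₂.map σ)ᵀ = H₂) {γ₂ : GL (Fin 2) K} (hγ : γ₂ ∈ unitaryGroupOfForm σ H₂)
    {c : K} (htr : (γ₂ : Matrix (Fin 2) (Fin 2) K).trace = 2 * c) (hc : Valued.v (c - 1) < 1) (hD : Valued.v (c ^ 2 - (γ₂ : Matrix (Fin 2) (Fin 2) K).det) < 1) :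
    {B : Submodule 𝒪[K] (Fin 2 → K) | IsSelfDualLattice σ ϖ H₂ B ∧ mapGL γ₂ B = B ∧
        ¬ B.map ((Matrix.toLin' ((γ₂ : Matrix (Fin 2) (Fin 2) K) - 1)).restrictScalars 𝒪[K]) ≤ scaleLattice ϖ B} = ∅ :=
  Set.eq_empty_iff_forall_notMem.2 fun _ ⟨hB, hfix, hbd⟩ => hbd (map_sub_one_le_scaleLattice_of_fixed_selfDual_two hσ hϖ hres h2 hH₂ hγ htr hc hD hB hfix)

/-- **The `W`-side `reg` set is EMPTY** for a deep type-(2) block (`|c − 1| ≤ |ϖ|²`, `|c² − det| ≤ |ϖ|⁴`: `LEV ϖ` forces `LEV₂(ϖ³)`). [cite: Kottwitz1986, §3] [cite: Rogawski1990, §4.9 p. 55] -/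
theorem setOf_selfDual_fixed_reg_two_eq_empty {ϖ : K} (hϖ : Valued.v ϖ = WithZero.exp (-1 : ℤ)) {H₂ : Matrix (Fin 2) (Fin 2) K} (γ₂ : GL (Fin 2) K)
    {c : K} (htr : (γ₂ : Matrix (Fin 2) (Fin 2) K).trace = 2 * c) (hc : Valued.v (c - 1) ≤ Valued.v ϖ ^ 2)
    (hD : Valued.v (c ^ 2 - (γ₂ : Matrix (Fin 2) (Fin 2) K).det) ≤ Valued.v ϖ ^ 4) :
    {B : Submodule 𝒪[K] (Fin 2 → K) | IsSelfDualLattice σ ϖ H₂ B ∧ mapGL γ₂ B = B ∧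
        (B.map ((Matrix.toLin' ((γ₂ : Matrix (Fin 2) (Fin 2) K) - 1)).restrictScalars 𝒪[K]) ≤ scaleLattice ϖ B ∧
          ¬ B.map ((Matrix.toLin' ((γ₂ : Matrix (Fin 2) (Fin 2) K) - 1)).restrictScalars 𝒪[K]) ≤ scaleLattice (ϖ ^ 2) B ∧
          ¬ B.map ((Matrix.toLin' (((γ₂ : Matrix (Fin 2) (Fin 2) K) - 1) ^ 2)).restrictScalars 𝒪[K]) ≤ scaleLattice (ϖ ^ 3) B)} = ∅ :=
  Set.eq_empty_iff_forall_notMem.2 fun B ⟨_, _, hlev, _, hrk⟩ => hrk (map_sq_sub_one_le_scaleLattice_three_of_trace_eq hϖ _ htr hc hD B hlev)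

/-- **`LEV₂(ϖ³)` IS REDUNDANT IN THE `1±` SETS** (`|c − 1| ≤ |ϖ|²`, `|c² − det| ≤ |ϖ|⁴`), for any extra predicate `P` (the class token or its negation).
[cite: Kottwitz1986, §3] [cite: Rogawski1990, §4.9 p. 55] -/
theorem setOf_selfDual_fixed_rankOne_two_eq {ϖ : K} (hϖ : Valued.v ϖ = WithZero.exp (-1 : ℤ)) {H₂ : Matrix (Fin 2) (Fin 2) K} (γ₂ : GL (Fin 2) K)
    {c : K} (htr : (γ₂ : Matrix (Fin 2) (Fin 2) K).trace = 2 * c) (hc : Valued.v (c - 1) ≤ Valued.v ϖ ^ 2)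
    (hD : Valued.v (c ^ 2 - (γ₂ : Matrix (Fin 2) (Fin 2) K).det) ≤ Valued.v ϖ ^ 4) (P : Submodule 𝒪[K] (Fin 2 → K) → Prop) :
    {B : Submodule 𝒪[K] (Fin 2 → K) | IsSelfDualLattice σ ϖ H₂ B ∧ mapGL γ₂ B = B ∧
        (B.map ((Matrix.toLin' ((γ₂ : Matrix (Fin 2) (Fin 2) K) - 1)).restrictScalars 𝒪[K]) ≤ scaleLattice ϖ B ∧
          ¬ B.map ((Matrix.toLin' ((γ₂ : Matrix (Fin 2) (Fin 2) K) - 1)).restrictScalars 𝒪[K]) ≤ scaleLattice (ϖ ^ 2) B ∧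
          B.map ((Matrix.toLin' (((γ₂ : Matrix (Fin 2) (Fin 2) K) - 1) ^ 2)).restrictScalars 𝒪[K]) ≤ scaleLattice (ϖ ^ 3) B ∧ P B)} =
      {B : Submodule 𝒪[K] (Fin 2 → K) | IsSelfDualLattice σ ϖ H₂ B ∧ mapGL γ₂ B = B ∧
        (B.map ((Matrix.toLin' ((γ₂ : Matrix (Fin 2) (Fin 2) K) - 1)).restrictScalars 𝒪[K]) ≤ scaleLattice ϖ B ∧
          ¬ B.map ((Matrix.toLin' ((γ₂ : Matrix (Fin 2) (Fin 2) K) - 1)).restrictScalars 𝒪[K]) ≤ scaleLattice (ϖ ^ 2) B ∧ P B)} :=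
  Set.ext fun B => ⟨fun ⟨h1, h2, h3, h4, _, h6⟩ => ⟨h1, h2, h3, h4, h6⟩,
    fun ⟨h1, h2, h3, h4, h6⟩ => ⟨h1, h2, h3, h4, map_sq_sub_one_le_scaleLattice_three_of_trace_eq hϖ _ htr hc hD B h3, h6⟩⟩

end Literature.NumberTheory.Automorphic.UnitaryLatticeTree

end
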